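import Mathlib
import Summits.NavierStokesRegularity.NavierStokesRegularity.Theorems.EulerZoomLiouvillePowerGaugeEulerLiouvilleSelfSimilarStrainExcessGrowth
import Summits.NavierStokesRegularity.NavierStokesRegularity.Theorems.EulerZoomLiouvillePowerGaugeEulerLiouvilleSelfSimilarVortexDominated
import Summits.NavierStokesRegularity.NavierStokesRegularity.Theorems.EulerZoomLiouvillePowerGaugeEulerLiouvilleClockTransfer
import HarnessLib

/-!
# The T2 strata about ANY collapse centre `(T, x₀)` with `T ≤ 0` (the `T₁ = T` past twin, by ezl-w6's CLOCK TRANSFER) for the crux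
# `EulerZoomLiouville.PowerGaugeEulerLiouville` (stmt-NavierStokesRegularity-19832; LEAD ns-typeII-p2 g12 v75 «past twin: yes please»; width seat ns-ezl-w1 g4)

Route №10 `EulerZoomLiouville` (NavierStokesRegularity).  The T2 strata `…SelfSimilarVortexDominated` (p654412) and `…SelfSimilarStrainExcessGrowth`
(p655557) are origin-anchored (`u τ = selfSimilarCollapse γ 0 V τ` for `τ < 0`), but their hypotheses — bounded vortical Bernoulli levels for every
classical pressure of `V`, and the kinematic far-field bound on the strain excess of `V` — are properties of the PROFILE alone.  ezl-w6 g2's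
centre/exponent transfer `ClockTransfer.ae_eq_zero_of_originAnalysis` (p640181: a member exactly self-similar about `(T, x₀)` for ALL `τ < T ≤ 0` yields an
origin-anchored class member with the same profile) therefore moves both strata to any centre `(T, x₀)`, `T ≤ 0`, representation valid for all
`τ < T` (the `T₁ = T` case of the skeleton's `IsPastSelfSimilar ρ T T₁ x₀ u V`):

* `selfSimilar_ae_eq_zero_of_strainExcessGrowth_boundedVorticalBernoulliC2_collapse`,
* `selfSimilar_ae_eq_zero_of_vortexDominated_boundedVorticalBernoulliC2_collapse`.

The genuinely PAST case `T₁ < T` (representation stopping before the collapse) does not transfer this way; it needs the past form of the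
profile `D`-datum (`profile_pressure_weight_of_gaugeD`) and of the bridge `P = P′ + c₀` — next generation.
HONEST LABEL: portrait strata, `T₁ = T` only.  WHAT THIS IS NOT: not NS, not E — `--supports` stmt-19832; 19832 OPEN. [folklore]
-/

noncomputable section

-- flat `Theorems/<Route><Decl>…` files of one crux share the namespace of the crux (tree convention)
set_option linter.dupNamespace false

open MeasureTheory Set Filter Topology Metric Function InnerProductSpace TopologicalSpace
open scoped RealInnerProductSpace NNReal ENNReal

namespace Summit.NavierStokesRegularity.NavierStokesRegularity.Theorems.PowerGaugeEulerLiouville.PressureParking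

open Literature.Analysis Literature.Analysis.FunctionSpaces Literature.Analysis.FluidPDE

/-- **T2 STRATUM (growth form) ABOUT ANY CENTRE `(T, x₀)`, `T ≤ 0`, representation for all `τ < T`**: crux hypotheses verbatim (`0 < ρ ≤ ½`),
`u(τ, x) = (T−τ)^{γ−1} W((T−τ)^{−γ}(x − x₀))`, `p` likewise with profile `Q`, for all `τ < T`; `W ∈ C²`; bounded vortical Bernoulli levels for every
classical pressure of `W`; strain excess `|∇W(z)|²_F − |curl W(z)|² ≤ A‖z‖^q` far out with `0 ≤ q < 2 + ⅔(1+2ρ)` ⇒ the member is trivial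
(`ClockTransfer.ae_eq_zero_of_originAnalysis` + `selfSimilar_ae_eq_zero_of_strainExcessGrowth_boundedVorticalBernoulliC2_profile`). [folklore] -/
theorem selfSimilar_ae_eq_zero_of_strainExcessGrowth_boundedVorticalBernoulliC2_collapse {ρ T : ℝ} (hρ : 0 < ρ) (hρ1 : ρ ≤ 1 / 2)
    {u : ℝ → EuclideanSpace ℝ (Fin 3) → EuclideanSpace ℝ (Fin 3)} {p : ℝ → EuclideanSpace ℝ (Fin 3) → ℝ}
    {H : ℝ → EuclideanSpace ℝ (Fin 3) → EuclideanSpace ℝ (Fin 3) →L[ℝ] EuclideanSpace ℝ (Fin 3)} {c : ℝ≥0}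
    (hsw : IsSuitableWeakSolutionOn (slab (EuclideanSpace ℝ (Fin 3)) (Iio 0) isOpen_Iio) 0 0 u p)
    (hH : HasWeakSpatialGradientOn (slab (EuclideanSpace ℝ (Fin 3)) (Iio 0) isOpen_Iio) u H)
    (hgauge : ∀ a : ℝ, 0 < a →
      ENNReal.ofReal (a ^ (2 * ρ)) * cknA a (0 : ℝ × EuclideanSpace ℝ (Fin 3)) u +
          ENNReal.ofReal (a ^ ρ) * cknE a (0 : ℝ × EuclideanSpace ℝ (Fin 3)) H +
        ENNReal.ofReal (a ^ (2 * ρ)) * cknD a (0 : ℝ × EuclideanSpace ℝ (Fin 3)) p ≤ (c : ℝ≥0∞))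
    (hT : T ≤ 0) (x₀ : EuclideanSpace ℝ (Fin 3))
    {W : EuclideanSpace ℝ (Fin 3) → EuclideanSpace ℝ (Fin 3)} {Q : EuclideanSpace ℝ (Fin 3) → ℝ}
    (hu : ∀ τ : ℝ, τ < T → u τ = fun x => selfSimilarCollapse (1 / (2 + ρ)) T W τ (x - x₀))
    (hp : ∀ τ : ℝ, τ < T → p τ = fun x => selfSimilarCollapsePressure (1 / (2 + ρ)) T Q τ (x - x₀))
    (hW : ContDiff ℝ 2 W)
    (hB : ∀ P' : EuclideanSpace ℝ (Fin 3) → ℝ, IsSelfSimilarEulerProfile (1 / (2 + ρ)) 0 W P' →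
      ∃ Mb : ℝ, ∀ y, curl W y ≠ 0 → selfSimilarBernoulli (1 / (2 + ρ)) 0 W P' y ≤ Mb)
    (hQ : ∃ A q R₀ : ℝ, 0 ≤ A ∧ 0 ≤ q ∧ q < 2 + 2 * (1 + 2 * ρ) / 3 ∧
      ∀ z : EuclideanSpace ℝ (Fin 3), R₀ ≤ ‖z‖ → frobeniusNormSq (fderiv ℝ W z) - ‖curl W z‖ ^ 2 ≤ A * ‖z‖ ^ q) :
    uncurry u =ᵐ[volume.restrict (Iio (0 : ℝ) ×ˢ (univ : Set (EuclideanSpace ℝ (Fin 3))))] 0 :=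
  ClockTransfer.ae_eq_zero_of_originAnalysis hρ.le (by linarith) (by linarith) hsw hH hgauge hT x₀ hu hp hW
    fun _ _ _ _ hcls hss =>
      selfSimilar_ae_eq_zero_of_strainExcessGrowth_boundedVorticalBernoulliC2_profile hρ hρ1 hcls.1 hcls.2.2 hss.1 hss.2
        hW hB hQ

/-- **T2 STRATUM (vortex-dominated form) ABOUT ANY CENTRE `(T, x₀)`, `T ≤ 0`, representation for all `τ < T`**: as above with the far field
vortex-dominated, `|∇W(z)|²_F ≤ |curl W(z)|²` for `‖z‖ ≥ R₀`. [folklore] -/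
theorem selfSimilar_ae_eq_zero_of_vortexDominated_boundedVorticalBernoulliC2_collapse {ρ T : ℝ} (hρ : 0 < ρ) (hρ1 : ρ ≤ 1 / 2)
    {u : ℝ → EuclideanSpace ℝ (Fin 3) → EuclideanSpace ℝ (Fin 3)} {p : ℝ → EuclideanSpace ℝ (Fin 3) → ℝ}
    {H : ℝ → EuclideanSpace ℝ (Fin 3) → EuclideanSpace ℝ (Fin 3) →L[ℝ] EuclideanSpace ℝ (Fin 3)} {c : ℝ≥0}
    (hsw : IsSuitableWeakSolutionOn (slab (EuclideanSpace ℝ (Fin 3)) (Iio 0) isOpen_Iio) 0 0 u p)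
    (hH : HasWeakSpatialGradientOn (slab (EuclideanSpace ℝ (Fin 3)) (Iio 0) isOpen_Iio) u H)
    (hgauge : ∀ a : ℝ, 0 < a →
      ENNReal.ofReal (a ^ (2 * ρ)) * cknA a (0 : ℝ × EuclideanSpace ℝ (Fin 3)) u +
          ENNReal.ofReal (a ^ ρ) * cknE a (0 : ℝ × EuclideanSpace ℝ (Fin 3)) H +
        ENNReal.ofReal (a ^ (2 * ρ)) * cknD a (0 : ℝ × EuclideanSpace ℝ (Fin 3)) p ≤ (c : ℝ≥0∞))
    (hT : T ≤ 0) (x₀ : EuclideanSpace ℝ (Fin 3))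
    {W : EuclideanSpace ℝ (Fin 3) → EuclideanSpace ℝ (Fin 3)} {Q : EuclideanSpace ℝ (Fin 3) → ℝ}
    (hu : ∀ τ : ℝ, τ < T → u τ = fun x => selfSimilarCollapse (1 / (2 + ρ)) T W τ (x - x₀))
    (hp : ∀ τ : ℝ, τ < T → p τ = fun x => selfSimilarCollapsePressure (1 / (2 + ρ)) T Q τ (x - x₀))
    (hW : ContDiff ℝ 2 W)
    (hB : ∀ P' : EuclideanSpace ℝ (Fin 3) → ℝ, IsSelfSimilarEulerProfile (1 / (2 + ρ)) 0 W P' →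
      ∃ Mb : ℝ, ∀ y, curl W y ≠ 0 → selfSimilarBernoulli (1 / (2 + ρ)) 0 W P' y ≤ Mb)
    (hQ : ∃ R₀ : ℝ, ∀ z : EuclideanSpace ℝ (Fin 3), R₀ ≤ ‖z‖ → frobeniusNormSq (fderiv ℝ W z) ≤ ‖curl W z‖ ^ 2) :
    uncurry u =ᵐ[volume.restrict (Iio (0 : ℝ) ×ˢ (univ : Set (EuclideanSpace ℝ (Fin 3))))] 0 :=
  ClockTransfer.ae_eq_zero_of_originAnalysis hρ.le (by linarith) (by linarith) hsw hH hgauge hT x₀ hu hp hW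
    fun _ _ _ _ hcls hss =>
      selfSimilar_ae_eq_zero_of_vortexDominated_boundedVorticalBernoulliC2_profile hρ hρ1 hcls.1 hcls.2.2 hss.1 hss.2 hW hB hQ

end Summit.NavierStokesRegularity.NavierStokesRegularity.Theorems.PowerGaugeEulerLiouville.PressureParking

end
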